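import Literature.Analysis.FluidPDE.ForcedFourierMildClassical
import Literature.Analysis.FluidPDE.ForcedFourierForcePressureData
import Literature.Analysis.FluidPDE.ForcedFourierForceDataSobolev
import Literature.Analysis.FluidPDE.TaoH1LocalExistenceForced
import HarnessLib

/-!
# Tao (2011/2013), Thm. 5.4 (ii)+(iv) WITH FORCING: the assembly of the three halves of the
# forced Fourier–Picard engine, modulo the Fourier-side existence statement

Analysis/FluidPDE proof file (no definitions, no named facts) towards the discharge of the named
fact `tao2011_smooth_local_existence_forced` (`TaoH1LocalExistenceForced.lean`; T. Tao,
*Localisation and compactness properties of the Navier–Stokes global regularity problem*, Anal. PDE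
6 (2013) 25–107 = arXiv:1108.1165, Thm. 5.4 = arXiv Thm. 31 (p. 18), (ii) + (iv) with (i) and the
note closing the proof of (iv), the INHOMOGENEOUS case). Tao proves (ii) "by repeating the proof
of Theorem 28 verbatim" (the contraction of the forced Duhamel map, p. 16) and (iv) by "`u ∈ X^k`
for all `k`, then (pressure-point) [with `p = −Δ⁻¹∂ᵢ∂ⱼ(uᵢuⱼ) + Δ⁻¹∇·f`, (8)] and Sobolev
embedding". In the tree the forced engine is run on the Fourier side in three halves:

* the EXISTENCE half (seat `ns-blowup-lean2`; `ForcedFourierDuhamelDefs` / `…Forcing` /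
  `ForcedFourierPicard*`): a Fourier-side mild solution `v` of Sobolev class of the FORCED system,
  `IsSobolevMildForced (4π²ν) T a b v`, for a measurable datum `a` of Sobolev class and PROJECTED
  force coefficients `b` (divergence free on the Fourier side), under the smallness
  `(A + B T)⁴ T ≤ c₀ ν³` — NOT YET IN THE TREE when this file was written;
* the CLASSICAL half (seat `ns-blowup-ecbridge-7`; `ForcedFourierMildFamily` / `…Solution` /
  `…Classical`): `IsSobolevMildForced.classical` — the synthesis `u(t) = Re 𝓕 v(t)` with the
  pressure `Re 𝓕 presSymbol (v t) (v t)` is a classical solution on the closed slab driven by the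
  synthesized PROJECTED force `synthVel (b t)`, with `u, ∂ₜu, p ∈ L^∞_t H^k_x`, `u ∈ C([0,T]; L²)`;
* the PHYSICAL TRANSFER and RAW-FORCE GAUGE (seats `ns-blowup-lit`, `ns-blowup-lit3`;
  `ForcedFourierForceData` / `…ForceFamily` / `…ForcePressure` / `…ForcePressureData`): the
  Fourier-side force `forceData hT hf hd` of a Schwartz-on-slab physical force `f`, its Leray
  projection `b t ξ = lerayPart (forceData … t) ξ` with all the properties the other halves consume
  (jointly measurable, continuous in `t` at each `ξ`, uniform decay, divergence free, conjugation
  symmetric, a pointwise-decaying time-derivative tower), and the adapter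
  `exists_classical_rawForce_of_lerayPart_forceData` from the projected force to the raw force `f`
  with the pressure `p + Δ⁻¹∇·f`;

plus the glue `ForcedFourierForceDataSobolev` (this seat): the `H¹` quantity of the force slices
on the Fourier side equals the physical one (`fourierH1Sq_forceData`), and does not increase under
the Leray projection (`fourierH1Sq_lerayPart_le`).

This file proves:

* `exists_classical_forced_of_isSobolevMildForced` — **the post-existence assembly**: for
  `ν, T > 0`, a physical force `f` Schwartz on `[0, T] × ℝ³`, a datum `a` of Sobolev class and ANY
  `v` with `IsSobolevMildForced (4π²ν) T a (P ∘ forceData) v`, there are `u` (`= synthVel ∘ v`)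
  and `p` with `IsClassicalNSSolutionOn (Icc 0 T) ν f u p`, `u 0 = synthVel a`, and all the bounds
  in the conclusion of `tao2011_smooth_local_existence_forced`;
* `tao2011_smooth_local_existence_forced_of_exists` — **the reduction of the named fact to the
  Fourier-side existence statement**, spelled out as the hypothesis `hE` (an absolute constant
  `c₀ > 0` such that for a measurable datum `a` of Sobolev class and force coefficients `b` that
  are jointly measurable, continuous in time at each frequency, uniformly polynomially decaying of
  every order, divergence free and conjugation symmetric, with `fourierH1Sq a ≤ A²`,
  `fourierH1Sq (b t) ≤ B²` for all `t` and `(A + B T)⁴ T ≤ c₀ ν³`, there is `v` with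
  `IsSobolevMildForced (4π²ν) T a b v`): `hE → tao2011_smooth_local_existence_forced`, with the
  same constant. The datum is transferred by `exists_isSobolevFourierDatum` (Plancherel,
  `TaoH1FourierDecompositionProofs`) and `IsSobolevFourierDatum.exists_measurable_repr`, the force
  by the lemmas listed above. NOTE on `hE`: the hypotheses on `b` are EXACTLY those the projected
  force of an arbitrary Schwartz force satisfies — in particular NOT joint continuity in `(t, ξ)`,
  which fails at `ξ = 0` unless `∫ f(t, x) dx = 0` (`ForcedFourierDuhamelForcingMeasurable`).

* `tao2011_smooth_local_existence_forced_of_exists'` — the same reduction in the binder shape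
  announced by the existence half's seat (squared `H¹` quantities, force bound on `[0, T]`,
  smallness `(A + T² B)² T ≤ c₀ ν³`), proved from the previous one by
  `(A′² + T² B′²)² ≤ (A′ + B′ T)⁴`.

When the existence half lands as a theorem `T_exists` of (a shape implying) the shape of `hE` or
`hE'`, the discharge is the one-liner
`theorem tao2011_smooth_local_existence_forced_holds := tao2011_smooth_local_existence_forced_of_exists' T_exists`
(in a separate file importing both).

## Mathlib / tree search

Tree (reused): `IsSobolevMildForced`, `IsSobolevMildForced.apply_zero` (`ForcedFourierDuhamelDefs`);
`IsSobolevMildForced.classical` (`ForcedFourierMildClassical`); `forceData`,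
`exists_lerayPart_forceData_tower`, `lerayPart_forceData_conj_symm`,
`measurable_uncurry_lerayPart_forceData`, `continuous_lerayPart_forceData_time`,
`hasDecay_lerayPart_forceData_uniform`, `sum_mul_lerayPart_forceData`,
`exists_classical_rawForce_of_lerayPart_forceData` (`ForcedFourierForcePressureData`);
`fourierH1Sq_lerayPart_forceData_le_of_forall_mem` (`ForcedFourierForceDataSobolev`);
`exists_isSobolevFourierDatum` (`TaoH1FourierDecompositionProofs`),
`IsSobolevFourierDatum.exists_measurable_repr` (`TaoH1FourierMild`), `fourierH1Sq`
(`TaoH1FourierDecomposition`). `lean search 'tao2011_smooth_local_existence_forced_'`: only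
`.unforced` (`TaoH1LocalExistenceForcedUnforced`) before this file.

## References

* T. Tao, Anal. PDE 6 (2013) 25–107 = arXiv:1108.1165: Def. 1.1 and (3)–(8) (pp. 2–3), `H¹` mild
  solutions (p. 6), footnote 3 (p. 4), Lemma 2.1 = arXiv Lemma 23 (p. 10), Thm. 5.4 = arXiv
  Thm. 31 (p. 18) with the proof of Thm. 5.1 = arXiv Thm. 28 (p. 16) and the note closing the proof
  of (iv). [Tao2011]
* E. M. Stein, G. Weiss, *Introduction to Fourier analysis on Euclidean spaces*, Princeton 1971,
  Ch. I, Thm. 1.8 and Thm. 2.3 (Plancherel for the datum and the force). [SteinWeiss1971]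
-/

noncomputable section

open MeasureTheory Set Function Filter Real Complex FourierTransform
open scoped FourierTransform ENNReal NNReal ContDiff ComplexConjugate
open _root_.Topology

namespace Literature.Analysis.FluidPDE

open FourierNS

/-- **The post-existence assembly.** For `ν > 0`, `T > 0`, a physical force `f` jointly smooth on
`[0, T] × ℝ³` with Tao's Schwartz bounds there, a Fourier datum `a` of Sobolev class and a
Fourier-side mild solution `v` of Sobolev class of the system forced by the PROJECTED force
coefficients `b t ξ = lerayPart (forceData hT hf hd t) ξ` (`IsSobolevMildForced (4π²ν) T a b v`),
the synthesis `u(t) = synthVel (v t)` is, with a suitable pressure (`Re 𝓕 presSymbol (v t) (v t)`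
plus Tao's `Δ⁻¹∇·f`), a classical solution of the Navier–Stokes system WITH THE PHYSICAL FORCE `f`
on the closed slab `[0, T] × ℝ³`, with `u 0 = synthVel a`, `u, ∂ₜu, p ∈ L^∞_t H^k_x` for every
`k` and `u ∈ C([0, T]; L²)` — Tao's Thm. 5.4 (iv) with (i) for the forced `H¹` mild solution
(classical half `IsSobolevMildForced.classical` for the projected force, then the raw-force adapter
`exists_classical_rawForce_of_lerayPart_forceData`). [cite: Tao2011, Thm. 5.4 (iv) (arXiv Thm. 31) with (8)] -/
theorem exists_classical_forced_of_isSobolevMildForced {ν T : ℝ} (hν : 0 < ν) (hT : 0 < T)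
    {f : ℝ → EuclideanSpace ℝ (Fin 3) → EuclideanSpace ℝ (Fin 3)}
    (hf : IsSmoothSpaceTimeOn (Icc 0 T) f) (hd : HasUniformRapidDecayOn (Icc 0 T) f)
    {a : EuclideanSpace ℝ (Fin 3) → Fin 3 → ℂ} (ha : IsSobolevFourierDatum a)
    {v : ℝ → EuclideanSpace ℝ (Fin 3) → Fin 3 → ℂ}
    (hv : IsSobolevMildForced (4 * π ^ 2 * ν) T a
      (fun t ξ => lerayPart (forceData hT hf hd t) ξ) v) :
    ∃ (u : ℝ → EuclideanSpace ℝ (Fin 3) → EuclideanSpace ℝ (Fin 3))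
      (p : ℝ → EuclideanSpace ℝ (Fin 3) → ℝ),
      IsClassicalNSSolutionOn (Icc 0 T) ν f u p ∧ u 0 = synthVel a ∧
      HasBoundedSobolevNormsOn (Icc 0 T) u ∧
      HasBoundedSobolevNormsOn (Icc 0 T) (timeDerivWithin (Icc 0 T) u) ∧
      (∀ n : ℕ, ∃ C : ℝ≥0, ∀ t ∈ Icc 0 T, ∫⁻ x, ‖iteratedFDeriv ℝ n (p t) x‖ₑ ^ 2 ≤ C) ∧
      ContinuousInLpOn (Icc 0 T) 2 u := by
  -- the projected force tower (classical half's binders)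
  obtain ⟨B, hB0, -, hBD, hBconj, -⟩ := exists_lerayPart_forceData_tower hT hf hd
  have hbc : ∀ t ∈ Icc 0 T, ∀ ξ l, (fun t ξ => lerayPart (forceData hT hf hd t) ξ) t (-ξ) l =
      conj ((fun t ξ => lerayPart (forceData hT hf hd t) ξ) t ξ l) :=
    fun t _ ξ l => lerayPart_forceData_conj_symm hT hf hd t ξ l
  -- the classical half, for the projected force
  obtain ⟨p, hsol, hub, hutb, hpb, huc⟩ := hv.classical hν hT ha hB0 hBD hbc
  -- the raw-force gauge
  obtain ⟨p', hsol', hpb'⟩ := exists_classical_rawForce_of_lerayPart_forceData hT hf hd hsol hpb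
  refine ⟨fun t => synthVel (v t), p', hsol', ?_, hub, hutb, hpb', huc⟩
  -- the initial value
  change synthVel (v 0) = synthVel a
  congr 1
  funext ξ
  exact hv.apply_zero hT.le ξ

/-- **Reduction of `tao2011_smooth_local_existence_forced` to the Fourier-side existence
statement.** Suppose (`hE`) there is an absolute constant `c₀ > 0` such that: for `ν > 0`,
`T > 0`, a Borel measurable Fourier datum `a : ℝ³ → ℂ³` of Sobolev class, and force coefficients
`b : ℝ → ℝ³ → ℂ³` which are jointly measurable, continuous in time at every frequency, uniformly
(in `t`) polynomially decaying of every order, divergence free (`∑ₗ ξₗ bₗ = 0`) and conjugation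
symmetric, with `fourierH1Sq a ≤ A²`, `fourierH1Sq (b t) ≤ B²` for all `t` and
`(A + B T)⁴ T ≤ c₀ ν³`, there is a Fourier-side mild solution of Sobolev class of the forced system,
`IsSobolevMildForced (4π²ν) T a b v` — Tao's Thm. 5.4 (ii) WITH forcing on the Fourier side, for the
projected force (this is what the contraction of the forced Duhamel map, "repeating the proof of
Theorem 28 verbatim", p. 16/18, produces). Then `tao2011_smooth_local_existence_forced` holds with
the same constant: given the physical datum `u₀` (smooth, divergence free, `H^∞`) and force `f`
(Schwartz on the slab) with `‖u₀‖_{H¹} ≤ A`, `sup_t ‖f(t)‖_{H¹} ≤ B`, take `a` = a measurable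
representative of the Fourier datum of `u₀` (`exists_isSobolevFourierDatum`, Plancherel:
`fourierH1Sq a = ‖u₀‖²_{L²} + ‖∇u₀‖²_{L²} ≤ A²`) and `b = P ∘ forceData` (Plancherel for the force
slices and `‖P f‖_{H¹} ≤ ‖f‖_{H¹}`: `fourierH1Sq (b t) ≤ B²`), get `v` from `hE`, and conclude by
`exists_classical_forced_of_isSobolevMildForced` (`u 0 = synthVel a = u₀`).
[cite: Tao2011, Thm. 5.4 (ii)+(iv) (arXiv Thm. 31)] -/
theorem tao2011_smooth_local_existence_forced_of_exists
    (hE : ∃ c₀ : ℝ, 0 < c₀ ∧ ∀ ⦃ν T : ℝ⦄, 0 < ν → 0 < T →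
      ∀ ⦃a : EuclideanSpace ℝ (Fin 3) → Fin 3 → ℂ⦄, IsSobolevFourierDatum a → Measurable a →
      ∀ ⦃b : ℝ → EuclideanSpace ℝ (Fin 3) → Fin 3 → ℂ⦄,
        Measurable (uncurry b) → (∀ ξ, Continuous fun t => b t ξ) →
        (∀ K : ℕ, ∃ C : ℝ, ∀ t, HasDecay K C (b t)) →
        (∀ t ξ, ∑ l, ((ξ l : ℝ) : ℂ) * b t ξ l = 0) →
        (∀ t ξ l, b t (-ξ) l = conj (b t ξ l)) →
      ∀ ⦃A B : ℝ⦄, 0 ≤ A → 0 ≤ B → fourierH1Sq a ≤ ENNReal.ofReal (A ^ 2) →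
        (∀ t, fourierH1Sq (b t) ≤ ENNReal.ofReal (B ^ 2)) →
        (A + B * T) ^ 4 * T ≤ c₀ * ν ^ 3 →
        ∃ v : ℝ → EuclideanSpace ℝ (Fin 3) → Fin 3 → ℂ, IsSobolevMildForced (4 * π ^ 2 * ν) T a b v) :
    tao2011_smooth_local_existence_forced := by
  obtain ⟨c₀, hc₀, hE⟩ := hE
  refine ⟨c₀, hc₀, fun ν T hν hT u₀ hsm hdiv hH f hf hd A B hA hB hu₀ hfB hsmall => ?_⟩
  -- the datum on the Fourier side: Sobolev class, Plancherel, measurable representative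
  obtain ⟨a₀, ha₀, hsynth₀, hPl₀⟩ := exists_isSobolevFourierDatum hsm hdiv hH
  obtain ⟨a, ham, ha, -, hsynth, hH1eq⟩ := ha₀.exists_measurable_repr
  have haA : fourierH1Sq a ≤ ENNReal.ofReal (A ^ 2) := by
    rw [hH1eq, fourierH1Sq_eq, hPl₀]
    exact hu₀
  -- the projected force on the Fourier side
  set b : ℝ → EuclideanSpace ℝ (Fin 3) → Fin 3 → ℂ :=
    fun t ξ => lerayPart (forceData hT hf hd t) ξ with hb
  have hbm : Measurable (uncurry b) := measurable_uncurry_lerayPart_forceData hT hf hd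
  have hbt : ∀ ξ, Continuous fun t => b t ξ := continuous_lerayPart_forceData_time hT hf hd
  have hbd : ∀ K : ℕ, ∃ C : ℝ, ∀ t, HasDecay K C (b t) := fun K => by
    obtain ⟨C, -, hC⟩ := hasDecay_lerayPart_forceData_uniform hT hf hd K
    exact ⟨C, hC⟩
  have hbdiv : ∀ t ξ, ∑ l, ((ξ l : ℝ) : ℂ) * b t ξ l = 0 := sum_mul_lerayPart_forceData hT hf hd
  have hbconj : ∀ t ξ l, b t (-ξ) l = conj (b t ξ l) := lerayPart_forceData_conj_symm hT hf hd
  have hbB : ∀ t, fourierH1Sq (b t) ≤ ENNReal.ofReal (B ^ 2) :=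
    fourierH1Sq_lerayPart_forceData_le_of_forall_mem hT hf hd hfB
  -- the existence half
  obtain ⟨v, hv⟩ := hE hν hT ha ham hbm hbt hbd hbdiv hbconj hA hB haA hbB hsmall
  -- the classical half and the gauge
  obtain ⟨u, p, hsol, hu0, hub, hutb, hpb, huc⟩ :=
    exists_classical_forced_of_isSobolevMildForced hν hT hf hd ha hv
  refine ⟨u, p, hsol, ?_, hub, hutb, hpb, huc⟩
  rw [hu0, hsynth, hsynth₀]

/-- **Reduction in the announced binder shape of the existence half** (`ns-blowup-lean2`, cell
STATUS 2026-08-26T09:50Z): squared `H¹` quantities `A ~ ‖u₀‖²_{H¹}` (`fourierH1Sq a ≤ A`),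
`B ~ sup_{t ∈ [0,T]} ‖P f(t)‖²_{H¹}` (`fourierH1Sq (b t) ≤ B` on `[0, T]`) and the smallness
`(A + T² B)² T ≤ c₀ ν³`; a datum hypothesis `Measurable a` is offered in addition (drop it by
`fun … _ => …` if the existence theorem does not take it). Since
`(‖u₀‖²_{H¹} + T² sup‖f‖²_{H¹})² T ≤ (‖u₀‖_{H¹} + T sup‖f‖_{H¹})⁴ T`, the named fact's hypothesis
`(A′ + B′ T)⁴ T ≤ c ν³` implies this one with `A = A′²`, `B = B′²` and the SAME constant, so
`hE' → tao2011_smooth_local_existence_forced` (via `tao2011_smooth_local_existence_forced_of_exists`).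
[cite: Tao2011, Thm. 5.4 (ii)+(iv) (arXiv Thm. 31)] -/
theorem tao2011_smooth_local_existence_forced_of_exists'
    (hE' : ∃ c₀ : ℝ, 0 < c₀ ∧ ∀ ⦃ν T : ℝ⦄, 0 < ν → 0 < T →
      ∀ ⦃a : EuclideanSpace ℝ (Fin 3) → Fin 3 → ℂ⦄, IsSobolevFourierDatum a → Measurable a →
      ∀ ⦃b : ℝ → EuclideanSpace ℝ (Fin 3) → Fin 3 → ℂ⦄,
        Measurable (uncurry b) → (∀ ξ, Continuous fun t => b t ξ) →
        (∀ K : ℕ, ∃ C : ℝ, ∀ t, HasDecay K C (b t)) →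
        (∀ t ξ, ∑ l, ((ξ l : ℝ) : ℂ) * b t ξ l = 0) →
        (∀ t ξ l, b t (-ξ) l = conj (b t ξ l)) →
      ∀ ⦃A B : ℝ⦄, 0 ≤ A → 0 ≤ B → fourierH1Sq a ≤ ENNReal.ofReal A →
        (∀ t ∈ Icc 0 T, fourierH1Sq (b t) ≤ ENNReal.ofReal B) →
        (A + T ^ 2 * B) ^ 2 * T ≤ c₀ * ν ^ 3 →
        ∃ v : ℝ → EuclideanSpace ℝ (Fin 3) → Fin 3 → ℂ, IsSobolevMildForced (4 * π ^ 2 * ν) T a b v) :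
    tao2011_smooth_local_existence_forced := by
  obtain ⟨c₀, hc₀, hE'⟩ := hE'
  refine tao2011_smooth_local_existence_forced_of_exists ⟨c₀, hc₀, ?_⟩
  intro ν T hν hT a ha ham b hbm hbt hbd hbdiv hbconj A B hA hB haA hbB hsmall
  refine hE' hν hT ha ham hbm hbt hbd hbdiv hbconj (sq_nonneg A) (sq_nonneg B) haA
    (fun t _ => hbB t) ?_
  -- `(A² + T² B²)² T ≤ (A + B T)⁴ T ≤ c₀ ν³`
  have h1 : A ^ 2 + T ^ 2 * B ^ 2 ≤ (A + B * T) ^ 2 := by nlinarith [mul_nonneg hA hB, hT.le]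
  have h2 : (A ^ 2 + T ^ 2 * B ^ 2) ^ 2 ≤ ((A + B * T) ^ 2) ^ 2 :=
    pow_le_pow_left₀ (by positivity) h1 2
  calc (A ^ 2 + T ^ 2 * B ^ 2) ^ 2 * T ≤ ((A + B * T) ^ 2) ^ 2 * T :=
        mul_le_mul_of_nonneg_right h2 hT.le
    _ = (A + B * T) ^ 4 * T := by ring
    _ ≤ c₀ * ν ^ 3 := hsmall

end Literature.Analysis.FluidPDE

end
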